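import Mathlib.MeasureTheory.Measure.Real
import Mathlib.MeasureTheory.Measure.Typeclasses.Probability
import Mathlib.Tactic.Linarith
import HarnessLib

/-!
# `NoHeavyLowerTail` (stmt-CriticalPhenomena-4575) — the covariance triangle REDUCES to conditional decoupling (abstract measure form)

Support file (prover prim-facecert gen 10; `--supports stmt-CriticalPhenomena-4575`).  No definitions, no named facts, no sorries.

For ANY probability measure `μ` and events `U, A, B` (write `D = Uᶜ`), the covariance-triangle expression decomposes EXACTLY as
  `μ(D∖B)·Cov(U,A) + μ(D∖A)·Cov(U,B) − μ(D)²·Cov(A,B)  =  μ(D)·[μ(D∩A)μ(D∩B) − μ(D)μ(D∩A∩B)]  +  R2  +  Cov(U,A)·Cov(U,B)`,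
  `R2 := μ(U)·μ(D∩Aᶜ)·μ(D∩Bᶜ) − μ(D)²·μ(U∩Aᶜ∩Bᶜ)`
(inclusion–exclusion + `ring`), so CT follows from: the two-set/BHK row `μ(D)μ(D∩A∩B) ≤ μ(D∩A)μ(D∩B)`, the two Harris rows
`μ(U)μ(A) ≤ μ(U∩A)`, `μ(U)μ(B) ≤ μ(U∩B)`, and `R2 ≥ 0`.  In percolation (`U = {S~T}`, `A` increasing in `C_S`, `B` increasing in `C_T`) the first
three are theorems for every typed instance (`setTwoClusterExchange`, `prodBernoulli_harris`), so prim-ineq-prove-3's covariance triangle CT(S,T,A,B)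
is implied by the cubic R2(S,T,A,B) alone (`…CovTrianglePath` proves R2 and CT for the PATH instance; prim-facecert gen 10 certified R2 for all
2319 u-free typed four-point instances).
-/

namespace Summit.CriticalPhenomena.PercolationContinuityZ3.Theorems

namespace CovTrianglePath

open MeasureTheory Set

/-- **CT ⟸ two-set row + Harris + R2 (any probability space).**  See the file docstring for the identity behind it. [this work] -/
theorem covTriangle_of_r2 {Ω : Type*} [MeasurableSpace Ω] (μ : Measure Ω) [IsProbabilityMeasure μ] {U A B : Set Ω}
    (hU : MeasurableSet U) (hA : MeasurableSet A) (hB : MeasurableSet B)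
    (hCA : μ.real Uᶜ * μ.real (Uᶜ ∩ A ∩ B) ≤ μ.real (Uᶜ ∩ A) * μ.real (Uᶜ ∩ B))
    (hUA : μ.real U * μ.real A ≤ μ.real (U ∩ A)) (hUB : μ.real U * μ.real B ≤ μ.real (U ∩ B))
    (hR2 : μ.real Uᶜ ^ 2 * μ.real (U ∩ Aᶜ ∩ Bᶜ) ≤ μ.real U * μ.real (Uᶜ ∩ Aᶜ) * μ.real (Uᶜ ∩ Bᶜ)) :
    μ.real Uᶜ ^ 2 * (μ.real (A ∩ B) - μ.real A * μ.real B) ≤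
      μ.real (Uᶜ ∩ Bᶜ) * (μ.real (U ∩ A) - μ.real U * μ.real A) +
        μ.real (Uᶜ ∩ Aᶜ) * (μ.real (U ∩ B) - μ.real U * μ.real B) := by
  -- the seven atoms: μU, μ(U∩A), μ(Uᶜ∩A), μ(U∩B), μ(Uᶜ∩B), μ(U∩A∩B), μ(Uᶜ∩A∩B); every other mass is affine in them
  have eD : μ.real Uᶜ = 1 - μ.real U := probReal_compl_eq_one_sub hU
  have eA : μ.real A = μ.real (U ∩ A) + μ.real (Uᶜ ∩ A) := by
    have h := measureReal_inter_add_sdiff (μ := μ) (s := A) hU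
    rw [Set.sdiff_eq, Set.inter_comm A U, Set.inter_comm A Uᶜ] at h
    linarith
  have eB : μ.real B = μ.real (U ∩ B) + μ.real (Uᶜ ∩ B) := by
    have h := measureReal_inter_add_sdiff (μ := μ) (s := B) hU
    rw [Set.sdiff_eq, Set.inter_comm B U, Set.inter_comm B Uᶜ] at h
    linarith
  have eAB : μ.real (A ∩ B) = μ.real (U ∩ A ∩ B) + μ.real (Uᶜ ∩ A ∩ B) := by
    have h := measureReal_inter_add_sdiff (μ := μ) (s := A ∩ B) hU
    rw [Set.sdiff_eq, Set.inter_comm (A ∩ B) U, Set.inter_comm (A ∩ B) Uᶜ, ← Set.inter_assoc, ← Set.inter_assoc] at h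
    linarith
  have eDnB : μ.real (Uᶜ ∩ Bᶜ) = μ.real Uᶜ - μ.real (Uᶜ ∩ B) := by
    have h := measureReal_inter_add_sdiff (μ := μ) (s := Uᶜ) hB
    rw [Set.sdiff_eq] at h
    linarith
  have eDnA : μ.real (Uᶜ ∩ Aᶜ) = μ.real Uᶜ - μ.real (Uᶜ ∩ A) := by
    have h := measureReal_inter_add_sdiff (μ := μ) (s := Uᶜ) hA
    rw [Set.sdiff_eq] at h
    linarith
  have eUnA : μ.real (U ∩ Aᶜ) = μ.real U - μ.real (U ∩ A) := by
    have h := measureReal_inter_add_sdiff (μ := μ) (s := U) hA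
    rw [Set.sdiff_eq] at h
    linarith
  have eUnAB : μ.real (U ∩ Aᶜ ∩ B) = μ.real (U ∩ B) - μ.real (U ∩ A ∩ B) := by
    have h := measureReal_inter_add_sdiff (μ := μ) (s := U ∩ B) hA
    rw [Set.sdiff_eq, Set.inter_right_comm U B A, Set.inter_right_comm U B Aᶜ] at h
    linarith
  have em : μ.real (U ∩ Aᶜ ∩ Bᶜ) = μ.real (U ∩ Aᶜ) - μ.real (U ∩ Aᶜ ∩ B) := by
    have h := measureReal_inter_add_sdiff (μ := μ) (s := U ∩ Aᶜ) hB
    rw [Set.sdiff_eq] at h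
    linarith
  have p1 := mul_nonneg (measureReal_nonneg : 0 ≤ μ.real Uᶜ) (sub_nonneg.mpr hCA)
  have p2 := mul_nonneg (sub_nonneg.mpr hUA) (sub_nonneg.mpr hUB)
  have p3 := sub_nonneg.mpr hR2
  rw [em, eUnAB, eUnA, eDnA, eDnB] at p3
  rw [eDnA, eDnB, eAB, eA, eB]
  rw [eA, eB] at p2
  rw [eD] at p1 p3 ⊢
  linarith [p1, p2, p3]

end CovTrianglePath

end Summit.CriticalPhenomena.PercolationContinuityZ3.Theorems
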